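import Literature.AlgebraicGeometry.Hu2025.Statements.S01S09Interface.R110gSetupPrinted
import Mathlib

/-!
# [Hu22] p.131 printed setting (row 110 files e/g): residue characteristics on `X`, and EMPTINESS of the literal
# printed record `Hu22Setup_printed` at `𝔽 = ℚ` — kernel form of the typer's VACUITY DISCLOSURE (HOME STATUS
# 2026-08-27T10:27:05Z), for the J1 = HU-R01 reading (β) cell. OURS; nothing of the sources asserted.

**HONEST FRAMING (D-0012/D-0089).** [Hu2025]/[Hu2022] are unrefereed preprints under adjudication; their statements are typed
as candidates (rows 101–110) and consumed here only as hypotheses (`S : Hu22Setup …` / `S : Hu22Setup_printed …`). This file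
proves facts ABOUT OUR TYPED RECORDS, not about the sources:
* `Hu22Setup.ringChar_residueField_X` — for the LITERAL record of [Hu22] p.131 (file e, `Hu22Setup 𝔽 n d`): every point of
  `X` has residue characteristic `char 𝔽`. Reason (typed data only): `cell ↠ U` (`quot_surjective`), `U ↠ X` (`U_onto`), and
  `cellToGamma : cell ⟶ Z_{Γ_d} = Spec (𝔽[x_u]/I_{℘,Γ_d})` give, for every `x ∈ X`, a point `c ∈ cell` over `x` and field maps
  `𝔽 → κ(c) ← κ(x)`.
* `Hu22Setup_printed.isEmpty_X` — for the record WITH Thm 9.4's literal clause `X_thm94 : IsAffineFiniteTypeOverInt X` (file g,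
  `Hu22Setup_printed L ℚ n d`) at `𝔽 = ℚ`: `X` is EMPTY. Reason: `Γ(X, ⊤)` is a finitely generated `ℤ`-algebra; if `X` had a
  point, `Γ(X, ⊤)` would be nontrivial, a maximal ideal `m` would give a field `Γ(X, ⊤)/m` of finite type over `ℤ`, hence
  (`ℤ` Jacobson + Zariski's lemma `finite_of_finite_type_of_isJacobsonRing` + `(2 : K)⁻¹` integral over `ℤ` is absurd) NOT of
  characteristic `0` — while it maps into the residue field of the corresponding point of `X`, of characteristic `0` by the
  first item. Consequences: `cell` is empty, the Prop-9.1 locus of `Z_{Γ_d}/ℚ` is empty (`range_cellToGamma`), and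
  `Hu22P131L40_printed S` holds VACUOUSLY; for a `d` whose Prop-9.1 locus over `ℚ` is nonempty the record has NO inhabitant.
  The OURS sibling without the Spec-`ℤ` clause is file h (`Hu22Setup_printed_ours`), untouched by this.
* Mathlib gaps proved on the way (general): `int_isJacobsonRing : IsJacobsonRing ℤ` (private), `not_charZero_of_field_finiteType_int`.
The file is definition-free (theorems only).
No verdict word is implied: whether the printed sentence [Hu22] p.131 l.40–41 follows is the adjudicators' question (joint J1);
this file only says what the literal typed premises admit at `𝔽 = ℚ`. AI proof is weaker than expert review.
-/

noncomputable section

open CategoryTheory AlgebraicGeometry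

namespace Literature.AlgebraicGeometry.Hu2025.Statements.S01S09Interface

open S08MainTheorem S07GammaSchemes S03Pluecker

/-! ## General algebra (Mathlib gaps) -/

/-- **`ℤ` is a Jacobson ring**: every prime ideal is the intersection of the maximal ideals above it (`(0) = ⋂_p (p)` by the
infinitude of primes; nonzero primes of the PID `ℤ` are maximal). General fact, not in Mathlib at this snapshot (a
summit-tree file proves the same statement locally; kept `private` here — Literature cannot import Summits).
[cite: Hu2022, p.131 l.4–5 (setting of the J1 inference); joint J1 = GAP-LEDGER-HU row HU-R01 (unrefereed preprints arXiv:2203.03842v4 / arXiv:2507.21400v1 under adjudication, D-0012/D-0089 — general lemma used for a kernel statement about OUR typed records; nothing of the sources asserted)] -/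
private theorem int_isJacobsonRing : IsJacobsonRing ℤ := by
  rw [isJacobsonRing_iff_prime_eq]
  intro P hP
  by_cases h0 : P = ⊥
  · subst h0
    refine le_antisymm ?_ bot_le
    intro x hx
    rw [Ideal.jacobson, Submodule.mem_sInf] at hx
    by_contra hx0
    obtain ⟨p, hpgt, hp⟩ := Nat.exists_infinite_primes (x.natAbs + 1)
    have hpZ : Prime (p : ℤ) := Nat.prime_iff_prime_int.mp hp
    have hmax : (Ideal.span {(p : ℤ)}).IsMaximal := PrincipalIdealRing.isMaximal_of_irreducible hpZ.irreducible
    have hmem : x ∈ Ideal.span {(p : ℤ)} := hx _ ⟨bot_le, hmax⟩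
    rw [Ideal.mem_span_singleton, Int.natCast_dvd] at hmem
    have hxpos : 0 < x.natAbs := Int.natAbs_pos.mpr hx0
    have := Nat.le_of_dvd hxpos hmem
    omega
  · haveI : P.IsMaximal := IsPrime.to_maximal_ideal h0
    exact Ideal.jacobson_eq_self_of_isMaximal

/-- **A field that is a finitely generated `ℤ`-algebra is not of characteristic zero** (for any `ℤ`-algebra structure — they
are all equal). Proof: `ℤ` Jacobson ⇒ the field is module-finite over `ℤ` (Zariski's lemma,
`finite_of_finite_type_of_isJacobsonRing`) ⇒ `(2 : K)⁻¹` is integral over `ℤ`; in characteristic `0` it is the image of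
`1/2 ∈ ℚ`, which is not an integer (`ℤ` integrally closed) — absurd. General fact.
[cite: Hu2022, p.131 l.4–5 (setting of the J1 inference); joint J1 = GAP-LEDGER-HU row HU-R01 (unrefereed preprints arXiv:2203.03842v4 / arXiv:2507.21400v1 under adjudication, D-0012/D-0089 — general lemma used for a kernel statement about OUR typed records; nothing of the sources asserted)] -/
theorem not_charZero_of_field_finiteType_int (K : Type*) [Field K] [alg : Algebra ℤ K]
    [Algebra.FiniteType ℤ K] : ¬ CharZero K := by
  obtain rfl : alg = Ring.toIntAlgebra K := Subsingleton.elim _ _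
  intro hK
  haveI := int_isJacobsonRing
  haveI : Module.Finite ℤ K := finite_of_finite_type_of_isJacobsonRing ℤ K
  haveI : Algebra.IsIntegral ℤ K := Algebra.IsIntegral.of_finite ℤ K
  have hint : IsIntegral ℤ ((algebraMap ℚ K) (2 : ℚ)⁻¹) := Algebra.IsIntegral.isIntegral _
  have hinj : Function.Injective ((algebraMap ℚ K).toIntAlgHom : ℚ →ₐ[ℤ] K) := (algebraMap ℚ K).injective
  rw [show (algebraMap ℚ K) (2 : ℚ)⁻¹ = ((algebraMap ℚ K).toIntAlgHom) (2 : ℚ)⁻¹ from rfl,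
    isIntegral_algHom_iff _ hinj, IsIntegrallyClosed.isIntegral_iff] at hint
  obtain ⟨y, hy⟩ := hint
  have hy' : (y : ℚ) = (2 : ℚ)⁻¹ := by simpa using hy
  have h2 : (2 : ℚ) * (y : ℚ) = 1 := by rw [hy']; norm_num
  have h2' : ((2 * y : ℤ) : ℚ) = ((1 : ℤ) : ℚ) := by push_cast; exact h2
  have h3 : 2 * y = 1 := by exact_mod_cast h2'
  omega

/-! ## The literal record `Hu22Setup` (file e): residue characteristics on `X` -/

namespace Hu22Setup

variable {𝔽 : Type} [Field 𝔽] {n : ℕ} {M : HuMatroid n 3} (S : Hu22Setup 𝔽 n M)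

/-- The composite `cell ⟶ U ⟶ X × 𝔸^r ⟶ X` of the typed diagram (9.2) ([Hu22] p.131 l.17–26) is surjective on points (typed
data `quot_surjective` «π ↠» and `U_onto` «U projecting onto X»).
[cite: Hu2022, p.131 l.17–26 (diagram (9.2)) / Thm 9.4 p.130 l.45–46; joint J1 = GAP-LEDGER-HU row HU-R01 (unrefereed preprints arXiv:2203.03842v4 / arXiv:2507.21400v1 under adjudication, D-0012/D-0089 — kernel statement about OUR typed records of row 110; nothing of the sources asserted)] -/
theorem cellToX_surjective : Function.Surjective (S.quot ≫ S.U.ι ≫ (𝔸(Fin S.r; S.X) ↘ S.X)).base := by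
  have h1 : Function.Surjective S.quot.base := S.quot_surjective.surj
  have h2 : Function.Surjective (S.U.ι ≫ (𝔸(Fin S.r; S.X) ↘ S.X)).base := S.U_onto.surj
  intro x
  obtain ⟨u, hu⟩ := h2 x
  obtain ⟨c, hc⟩ := h1 u
  exact ⟨c, by rw [Scheme.Hom.comp_apply, hc]; exact hu⟩

/-- Every point of `cell` has residue characteristic `char 𝔽`: the ring map `𝔽 → 𝔽[x_u]/I_{℘,Γ_d} = Γ(Z_{Γ_d}, ⊤) →
Γ(cell, ⊤) → κ(c)` (typed datum `cellToGamma : cell ⟶ Z_{Γ_d}`, «Gr_d is an open subset of Z_Γ» [Hu22] p.131 l.39–40) is a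
map of fields out of `𝔽`.
[cite: Hu2022, p.131 l.39–40; joint J1 = GAP-LEDGER-HU row HU-R01 (unrefereed preprints arXiv:2203.03842v4 / arXiv:2507.21400v1 under adjudication, D-0012/D-0089 — kernel statement about OUR typed records of row 110; nothing of the sources asserted)] -/
theorem ringChar_residueField_cell (c : S.cell) : ringChar (S.cell.residueField c) = ringChar 𝔽 := by
  have φ : 𝔽 →+* S.cell.residueField c :=
    (S.cell.Γevaluation c).hom.comp <|
      (S.cellToGamma.appTop).hom.comp <|
        ((Scheme.ΓSpecIso (CommRingCat.of (GammaSchemeRing (primaryFamily n 𝔽) (GammaOfMatroidVar M)))).inv).hom.comp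
          (algebraMap 𝔽 (GammaSchemeRing (primaryFamily n 𝔽) (GammaOfMatroidVar M)))
  rw [ringChar.eq_iff]
  haveI : CharP 𝔽 (ringChar 𝔽) := ringChar.charP 𝔽
  exact (φ.charP_iff_charP (ringChar 𝔽)).mp inferInstance

/-- **Every point of `X` has residue characteristic `char 𝔽`** (for ANY inhabitant of the literal record of [Hu22] p.131:
`cell ↠ U ↠ X` and `cell ⊂ Z_{Γ_d}` over `𝔽`). In particular at `𝔽 = ℚ` no point of `X` has a residue field of positive
characteristic. [cite: Hu2022, p.131 l.4–41 (setting of the J1 inference); joint J1 = GAP-LEDGER-HU row HU-R01 (unrefereed preprints arXiv:2203.03842v4 / arXiv:2507.21400v1 under adjudication, D-0012/D-0089 — kernel statement about OUR typed records of row 110; nothing of the sources asserted)] -/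
theorem ringChar_residueField_X (x : S.X) : ringChar (S.X.residueField x) = ringChar 𝔽 := by
  obtain ⟨c, rfl⟩ := S.cellToX_surjective x
  have ψ : S.X.residueField ((S.quot ≫ S.U.ι ≫ (𝔸(Fin S.r; S.X) ↘ S.X)).base c) →+* S.cell.residueField c :=
    ((S.quot ≫ S.U.ι ≫ (𝔸(Fin S.r; S.X) ↘ S.X)).residueFieldMap c).hom
  rw [ringChar.eq_iff]
  haveI : CharP (S.cell.residueField c) (ringChar 𝔽) := by
    rw [← ringChar.eq_iff]; exact S.ringChar_residueField_cell c
  exact (ψ.charP_iff_charP (ringChar 𝔽)).mpr inferInstance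

end Hu22Setup

/-! ## The record with Thm 9.4's literal clause (file g) at `𝔽 = ℚ`: `X`, `cell` and the Prop-9.1 locus are EMPTY -/

namespace Hu22Setup_printed

variable {L : LafforgueObjects} {n : ℕ} {M : HuMatroid n 3} (S : Hu22Setup_printed L ℚ n M)

/-- **At `𝔽 = ℚ` the scheme `X` of an inhabitant of the literal printed record is EMPTY** (`X_thm94` «X affine of finite type
over Spec ℤ» + `Hu22Setup.ringChar_residueField_X`: a point would give a maximal ideal `m` of the nontrivial finitely
generated `ℤ`-algebra `Γ(X, ⊤)` whose residue field `Γ(X, ⊤)/m` — NOT of characteristic `0` by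
`not_charZero_of_field_finiteType_int` — embeds into the residue field of the corresponding point of `X`, of characteristic
`0`). The printed base tension of [Hu22] p.131 l.4–5 made kernel-explicit; no verdict on the printed sentence.
[cite: Hu2022, p.131 l.4–5 («X … over a perfect field k … defined over Spec ℤ. We apply Theorem 9.4 to X») with Thm 9.4 p.130 l.39–40; joint J1 = GAP-LEDGER-HU row HU-R01 (unrefereed preprints arXiv:2203.03842v4 / arXiv:2507.21400v1 under adjudication, D-0012/D-0089 — kernel statement about OUR typed records of row 110; nothing of the sources asserted)] -/
theorem isEmpty_X : IsEmpty S.X := by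
  by_contra hne
  rw [not_isEmpty_iff] at hne
  obtain ⟨x₀⟩ := hne
  obtain ⟨hAff, hFT⟩ := S.X_thm94
  haveI : IsAffine S.X := hAff
  -- `Γ(X, ⊤)` is of finite type over `ℤ`
  have hft : (specZIsTerminal.from S.X).appTop.hom.FiniteType :=
    (HasRingHomProperty.iff_of_isAffine (P := @LocallyOfFiniteType)).mp hFT
  haveI hftA : Algebra.FiniteType ℤ Γ(S.X, ⊤) := by
    have h' : ((specZIsTerminal.from S.X).appTop.hom.comp
        (Scheme.ΓSpecIso (CommRingCat.of ℤ)).inv.hom).FiniteType :=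
      hft.comp (RingHom.FiniteType.of_surjective _
        (Scheme.ΓSpecIso (CommRingCat.of ℤ)).commRingCatIsoToRingEquiv.symm.surjective)
    have heq : ((specZIsTerminal.from S.X).appTop.hom.comp
        (Scheme.ΓSpecIso (CommRingCat.of ℤ)).inv.hom) = algebraMap ℤ Γ(S.X, ⊤) := RingHom.ext_int _ _
    rw [heq] at h'
    exact RingHom.finiteType_algebraMap.mp h'
  -- `Γ(X, ⊤)` is nontrivial since `X` has a point
  haveI : Nontrivial Γ(S.X, ⊤) :=
    (S.X.presheaf.germ ⊤ x₀ trivial).hom.domain_nontrivial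
  -- a maximal ideal; its residue field is of finite type over `ℤ`, hence NOT of characteristic zero
  obtain ⟨m, hm⟩ := Ideal.exists_maximal Γ(S.X, ⊤)
  have hq : @Algebra.FiniteType ℤ (Γ(S.X, ⊤) ⧸ m) _ _ (Ideal.Quotient.algebra ℤ) :=
    Algebra.FiniteType.quotient ℤ m
  letI := Ideal.Quotient.field m
  have hK : ¬ CharZero (Γ(S.X, ⊤) ⧸ m) :=
    @not_charZero_of_field_finiteType_int (Γ(S.X, ⊤) ⧸ m) (Ideal.Quotient.field m) (Ideal.Quotient.algebra ℤ) hq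
  -- the point of `Spec Γ(X, ⊤)` at `m` and the field map `Γ(X, ⊤)/m → κ`
  let y : Spec Γ(S.X, ⊤) := (⟨m, hm.isPrime⟩ : PrimeSpectrum Γ(S.X, ⊤))
  have hker : ∀ a ∈ m, ((Spec Γ(S.X, ⊤)).Γevaluation y).hom ((Scheme.ΓSpecIso Γ(S.X, ⊤)).inv a) = 0 := by
    intro a ha
    rw [Scheme.evaluation_eq_zero_iff_notMem_basicOpen, basicOpen_eq_of_affine]
    exact fun hy => (PrimeSpectrum.mem_basicOpen a y).mp hy ha
  let φ : Γ(S.X, ⊤) ⧸ m →+* (Spec Γ(S.X, ⊤)).residueField y :=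
    Ideal.Quotient.lift m (((Spec Γ(S.X, ⊤)).Γevaluation y).hom.comp (Scheme.ΓSpecIso Γ(S.X, ⊤)).inv.hom) hker
  -- the corresponding point of `X` (through `X ≅ Spec Γ(X, ⊤)`) has residue characteristic `ringChar ℚ = 0`
  let ψ : S.X.residueField (S.X.isoSpec.inv.base y) →+* (Spec Γ(S.X, ⊤)).residueField y :=
    (S.X.isoSpec.inv.residueFieldMap y).hom
  haveI : CharP (S.X.residueField (S.X.isoSpec.inv.base y)) 0 := by
    rw [← ringChar.eq_iff, S.toHu22Setup.ringChar_residueField_X]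
    exact ringChar.eq_iff.mpr inferInstance
  haveI : CharP ((Spec Γ(S.X, ⊤)).residueField y) 0 := (ψ.charP_iff_charP 0).mp inferInstance
  haveI : CharP (Γ(S.X, ⊤) ⧸ m) 0 := (φ.charP_iff_charP 0).mpr inferInstance
  exact hK (CharP.charP_to_charZero _)

/-- At `𝔽 = ℚ`, `cell` is EMPTY too (it maps to the empty `X`).
[cite: Hu2022, p.131 l.4–41; joint J1 = GAP-LEDGER-HU row HU-R01 (unrefereed preprints arXiv:2203.03842v4 / arXiv:2507.21400v1 under adjudication, D-0012/D-0089 — kernel statement about OUR typed records of row 110; nothing of the sources asserted)] -/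
theorem isEmpty_cell : IsEmpty S.cell :=
  ⟨fun c => S.isEmpty_X.false ((S.quot ≫ S.U.ι ≫ (𝔸(Fin S.r; S.X) ↘ S.X)).base c)⟩

include S in
/-- At `𝔽 = ℚ`, the Prop-9.1 locus `{x ∈ Z_{Γ_d} ∣ x̄_u ∉ 𝔭_x for all u ∉ Γ_d}` is EMPTY for an inhabitant (it is the image of
the empty `cell`, field `range_cellToGamma` of file f).
[cite: Hu2022, p.131 l.27–28 with [Hu25] Prop. 9.1 (chunk p0072 l.71–82); joint J1 = GAP-LEDGER-HU row HU-R01 (unrefereed preprints arXiv:2203.03842v4 / arXiv:2507.21400v1 under adjudication, D-0012/D-0089 — kernel statement about OUR typed records of row 110; nothing of the sources asserted)] -/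
theorem prop91Locus_eq_empty :
    {x : PrimeSpectrum (GammaSchemeRing (primaryFamily n ℚ) (GammaOfMatroidVar M)) |
      ∀ u : plVar n, u ∉ GammaOfMatroidVar M →
        (Ideal.Quotient.mk (gammaWpIdeal (primaryFamily n ℚ) (GammaOfMatroidVar M)) (MvPolynomial.X u)) ∉ x.asIdeal}
      = ∅ := by
  haveI := S.isEmpty_cell
  rw [← S.range_cellToGamma]
  exact Set.range_eq_empty _

/-- **The literal printed record has NO inhabitant at `𝔽 = ℚ` once the Prop-9.1 locus of `Z_{Γ_d}/ℚ` is nonempty** (e.g. for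
every `d` realisable over `ℚ`). [cite: Hu2022, p.131 l.4–41 with [Hu25] Prop. 9.1 (chunk p0072 l.71–82); joint J1 = GAP-LEDGER-HU row HU-R01 (unrefereed preprints arXiv:2203.03842v4 / arXiv:2507.21400v1 under adjudication, D-0012/D-0089 — kernel statement about OUR typed records of row 110; nothing of the sources asserted)] -/
theorem isEmpty_of_prop91Locus_nonempty
    (h : {x : PrimeSpectrum (GammaSchemeRing (primaryFamily n ℚ) (GammaOfMatroidVar M)) |
      ∀ u : plVar n, u ∉ GammaOfMatroidVar M →
        (Ideal.Quotient.mk (gammaWpIdeal (primaryFamily n ℚ) (GammaOfMatroidVar M)) (MvPolynomial.X u)) ∉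
          x.asIdeal}.Nonempty) :
    IsEmpty (Hu22Setup_printed L ℚ n M) :=
  ⟨fun S => Set.not_nonempty_empty (S.prop91Locus_eq_empty ▸ h)⟩

/-- **`Hu22P131L40_printed` holds VACUOUSLY at `𝔽 = ℚ`** (its antecedent `IsIntegral X` needs a point of the empty `X`): the
literal carrier of reading (β) has content only at `𝔽 = 𝔽_p`; the non-vacuous OURS carrier is file h. No verdict on the printed
sentence. [cite: Hu2022, p.131 l.40–41; joint J1 = GAP-LEDGER-HU row HU-R01 (unrefereed preprints arXiv:2203.03842v4 / arXiv:2507.21400v1 under adjudication, D-0012/D-0089 — kernel statement about OUR typed records of row 110; nothing of the sources asserted)] -/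
theorem hu22P131L40_printed_rat : Hu22P131L40_printed S :=
  fun hX => (S.isEmpty_X.false hX.nonempty.some).elim

end Hu22Setup_printed

end Literature.AlgebraicGeometry.Hu2025.Statements.S01S09Interface

end
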